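import Literature.Barriers.CriticalPhenomena.KozmaNachmiasLemma52
import Literature.Barriers.CriticalPhenomena.KozmaNachmiasTheorem4
import HarnessLib

/-!
# Kozma–Nachmias 2011, Theorem 2 from Lemmas 5.1–5.2 and Theorem 4 (the assembly of Chapter 5)

Barrier catalogue `Literature/Barriers/CriticalPhenomena/` (D-0021), programme for the named fact
`KozmaNachmias2011_thm2` (Theorem 2 of Kozma–Nachmias 2011, p. 378 — the residual input of the
one-arm upper bound `KozmaNachmias2011_oneArmUpper`, see `KozmaNachmiasLemma23OfThm2.lean`).
Chapter 5 of the source (pp. 398–399, "Proof of Theorem 2") deduces Theorem 2 from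

* **Theorem 4** (the regularity theorem; PROVED, `KozmaNachmias2011_thm4_holds`,
  `KozmaNachmiasTheorem4.lean`),
* **Lemma 5.2** (the second moment `E[Y²; X^{K-reg} = M] ≤ C M² L⁴ P(X^{K-reg} = M)`; PROVED in summed
  form, `KozmaNachmias2011_lemma52`, `KozmaNachmiasLemma52.lean`),
* **Lemma 5.1** (the first moment `E[Y; X^{K-reg} = M] ≥ c M L² P(X^{K-reg} = M)`), vendored HERE as
  the named fact `KozmaNachmias2011_lemma51` in the same summed form as Lemma 5.2 (for the corrected
  count of `KozmaNachmiasAdmissible.lean`; its printed proof is Lemmas 5.3, 5.4, 5.5 and the local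
  modification of p. 404, to be discharged in sibling files),
* **(5.2)** `Y ≤ A_j` (PROVED, `admissibleCount_le_annulusConnCount`), and
* the lower bound `P(0 ↔ ∂Q_j) ≥ c/j²` (Lemma 2.2 of the source; PROVED,
  `TwoPointBoundedRatio.oneArmProb_lower`), which absorbs the error term `C j^d e^{-c log² L²}` of
  Theorem 4 for `L ≥ j^{1/10}` and `j` large (p. 399: "The first term is negligible … our theorem is
  only supposed to hold for `j` sufficiently large").

PROVED here:

* `sq_le_mul_measureReal_inter_lt_count` — the **Paley–Zygmund step** of p. 399
  ("`P(V > a) ≥ (E V − a)²/E V²` … for the variable `Y` conditioned on `X^{reg} = M`") in finite-sum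
  form: for a count `N = Σ_{a ∈ I} 1_{G_a}` and an event `H`, if `Σ_a P(G_a ∩ H) ≥ m`,
  `Σ_{a,b} P(G_a ∩ G_b ∩ H) ≤ s` and `θ P(H) ≤ m`, then `(m − θ P(H))² ≤ s · P(H ∩ {N > θ})`
  (partition by the value of `N`, the counting identity `sum_measureReal_inter_eq_mul` of
  `KozmaNachmiasE1.lean`, and the Cauchy–Schwarz inequality);
* **`KozmaNachmias2011_thm2_of_lemma51 : KozmaNachmias2011_lemma51 → KozmaNachmias2011_thm2`** —
  the printed proof of Theorem 2 (split (5.1) according to `X^{K-irr} ≥ X/2`, Theorem 4 for the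
  first part, Paley–Zygmund with Lemmas 5.1–5.2 and `A ≥ Y` for each `M ≥ L²/2`).

So after this file the trust base of `KozmaNachmias2011_thm2` (hence of
`KozmaNachmias2011_oneArmUpper`, `P_{p_c}(0 ↔ ∂Q_r) ≤ C r⁻²` for `d > 6` under the two-point
estimate (1.2)) is the single named fact `KozmaNachmias2011_lemma51` (Lemma 5.1, pp. 400–404).

## References

* G. Kozma, A. Nachmias, *Arm exponents in high dimensional percolation*, J. Amer. Math. Soc. 24
  (2011) 375–409 (arXiv:0911.0871): Thm. 2 (p. 378), (1.3)–(1.4); Chapter 5: admissible pairs,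
  `Y(j,L,K)`, Lemmas 5.1–5.2 (p. 398), "Proof of Theorem 2" with (5.1), (5.2) and the Paley–Zygmund
  inequality (p. 399); Lemma 2.2 (p. 381).
* R. Durrett, *Probability: Theory and Examples*, 4th ed., Ex. 1.6.? / (the inequality
  `P(V > a) ≥ (EV − a)²/EV²`, cited as [D] on p. 399 of the source).
-/

noncomputable section

namespace Literature.Barriers.CriticalPhenomena

open _root_.MeasureTheory Finset Literature.Probability.LatticeModels Literature.Probability.Percolation
  Literature.Probability.Percolation.DCT16
open scoped Literature.Probability.LatticeModels Literature.Probability.Percolation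

variable {d : ℕ}

/-! ### The Paley–Zygmund step in finite-sum form -/

section PaleyZygmund

variable {Ω ι : Type*} [MeasurableSpace Ω]

omit [MeasurableSpace Ω] in
/-- A count given in indicator form is at most the number of indices.
[cite: KozmaNachmias2011, proof of Thm. 2 (p. 399), Paley–Zygmund step (the count is bounded)] -/
theorem count_le_card_of_indicator (I : Finset ι) (G : ι → Set Ω) (N : Ω → ℕ)
    (hN : ∀ ω, (N ω : ℝ) = ∑ a ∈ I, (G a).indicator (1 : Ω → ℝ) ω) (ω : Ω) : N ω ≤ #I := by
  have h : (N ω : ℝ) ≤ #I := by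
    rw [hN ω]
    calc ∑ a ∈ I, (G a).indicator (1 : Ω → ℝ) ω ≤ ∑ _a ∈ I, (1 : ℝ) :=
          Finset.sum_le_sum fun a _ => Set.indicator_le_self' (fun _ _ => zero_le_one) ω
      _ = #I := by simp
  exact_mod_cast h

/-- **Partition by the value of a bounded count**: for measurable `A`,
`P(A ∩ H) = Σ_{n ≤ |I|} P(A ∩ ({N = n} ∩ H))`.
[cite: KozmaNachmias2011, proof of Thm. 2 (p. 399), Paley–Zygmund step (conditioning on the value of Y)] -/
theorem measureReal_inter_eq_sum_count (μ : Measure Ω) [IsFiniteMeasure μ] (I : Finset ι)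
    (G : ι → Set Ω) (N : Ω → ℕ) (hN : ∀ ω, (N ω : ℝ) = ∑ a ∈ I, (G a).indicator (1 : Ω → ℝ) ω)
    (hNm : Measurable N) {A H : Set Ω} (hA : MeasurableSet A) (hH : MeasurableSet H) :
    μ.real (A ∩ H) = ∑ n ∈ Finset.range (#I + 1), μ.real (A ∩ ({ω | N ω = n} ∩ H)) := by
  have hU : A ∩ H = ⋃ n ∈ Finset.range (#I + 1), (A ∩ ({ω | N ω = n} ∩ H)) := by
    ext ω
    simp only [Set.mem_iUnion, Set.mem_inter_iff, Set.mem_setOf_eq, exists_and_left, exists_prop,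
      Finset.mem_range]
    constructor
    · rintro ⟨hA', hH'⟩
      exact ⟨hA', N ω, rfl, Nat.lt_succ_of_le (count_le_card_of_indicator I G N hN ω), hH'⟩
    · rintro ⟨hA', n, -, -, hH'⟩
      exact ⟨hA', hH'⟩
  have hdisj : (↑(Finset.range (#I + 1)) : Set ℕ).PairwiseDisjoint
      fun n => A ∩ ({ω | N ω = n} ∩ H) := by
    intro n₁ _ n₂ _ hne
    rw [Function.onFun, Set.disjoint_left]
    rintro ω ⟨-, h₁, -⟩ ⟨-, h₂, -⟩
    exact hne (h₁.symm.trans h₂)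
  have hmeas : ∀ n, MeasurableSet ({ω | N ω = n} ∩ H) := fun n =>
    (hNm (measurableSet_singleton n)).inter hH
  rw [hU]
  exact measureReal_biUnion_finset hdisj fun n _ => hA.inter (hmeas n)

/-- **The Paley–Zygmund step of Kozma–Nachmias 2011, p. 399** ("Recall the inequality (see [D])
`P(V > a) ≥ (E V − a)²/E V²`, valid for any random variable `V ≥ 0` and `a < E V`. We use this for
the variable `Y` conditioned on `X^{reg} = M`"), in finite-sum form for a count
`N = Σ_{a ∈ I} 1_{G_a}` restricted to an event `H`: if `m ≤ Σ_a P(G_a ∩ H)` (`= E[N; H]`),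
`Σ_{a,b} P(G_a ∩ G_b ∩ H) ≤ s` (`= E[N²; H]`) and `θ P(H) ≤ m`, then
`(m − θ P(H))² ≤ s · P(H ∩ {N > θ})` (Cauchy–Schwarz on `E[N; H, N > θ]`).
[cite: KozmaNachmias2011, proof of Thm. 2 (p. 399), the Paley–Zygmund inequality [D]] -/
theorem sq_le_mul_measureReal_inter_lt_count (μ : Measure Ω) [IsFiniteMeasure μ] (I : Finset ι)
    (G : ι → Set Ω) (hG : ∀ a ∈ I, MeasurableSet (G a)) (N : Ω → ℕ)
    (hN : ∀ ω, (N ω : ℝ) = ∑ a ∈ I, (G a).indicator (1 : Ω → ℝ) ω) (hNm : Measurable N)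
    {H : Set Ω} (hH : MeasurableSet H) {m s θ : ℝ} (hθ : 0 ≤ θ)
    (h1 : m ≤ ∑ a ∈ I, μ.real (G a ∩ H))
    (h2 : ∑ a ∈ I, ∑ b ∈ I, μ.real (G a ∩ G b ∩ H) ≤ s) (hm : θ * μ.real H ≤ m) :
    (m - θ * μ.real H) ^ 2 ≤ s * μ.real (H ∩ {ω | θ < N ω}) := by
  classical
  set R : Finset ℕ := Finset.range (#I + 1) with hR
  set q : ℕ → ℝ := fun n => μ.real ({ω | N ω = n} ∩ H) with hq
  have hq0 : ∀ n, 0 ≤ q n := fun n => measureReal_nonneg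
  have hmeasF : ∀ n, MeasurableSet ({ω | N ω = n} ∩ H) := fun n =>
    (hNm (measurableSet_singleton n)).inter hH
  have hpart := fun {A : Set Ω} (hA : MeasurableSet A) =>
    measureReal_inter_eq_sum_count μ I G N hN hNm hA hH
  -- first moment: `Σ_a P(G_a ∩ H) = Σ_n n q_n`
  have hm1 : ∑ a ∈ I, μ.real (G a ∩ H) = ∑ n ∈ R, (n : ℝ) * q n := by
    calc ∑ a ∈ I, μ.real (G a ∩ H)
        = ∑ a ∈ I, ∑ n ∈ R, μ.real (G a ∩ ({ω | N ω = n} ∩ H)) :=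
          Finset.sum_congr rfl fun a ha => hpart (hG a ha)
      _ = ∑ n ∈ R, ∑ a ∈ I, μ.real (G a ∩ ({ω | N ω = n} ∩ H)) := Finset.sum_comm
      _ = ∑ n ∈ R, (n : ℝ) * q n :=
          Finset.sum_congr rfl fun n _ => sum_measureReal_inter_eq_mul μ I G hG N hN n (hmeasF n)
  -- second moment: `Σ_{a,b} P(G_a ∩ G_b ∩ H) = Σ_n n² q_n`
  have hm2 : ∑ a ∈ I, ∑ b ∈ I, μ.real (G a ∩ G b ∩ H) = ∑ n ∈ R, (n : ℝ) ^ 2 * q n := by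
    have hab : ∀ a ∈ I, ∑ b ∈ I, μ.real (G a ∩ G b ∩ H) =
        ∑ n ∈ R, (n : ℝ) * μ.real (G a ∩ ({ω | N ω = n} ∩ H)) := by
      intro a ha
      have hGaH : MeasurableSet (G a ∩ H) := (hG a ha).inter hH
      have hmeasF' : ∀ n, MeasurableSet ({ω | N ω = n} ∩ (G a ∩ H)) := fun n =>
        (hNm (measurableSet_singleton n)).inter hGaH
      calc ∑ b ∈ I, μ.real (G a ∩ G b ∩ H)
          = ∑ b ∈ I, μ.real (G b ∩ (G a ∩ H)) := Finset.sum_congr rfl fun b _ => by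
              congr 1; ext ω; simp only [Set.mem_inter_iff]; tauto
        _ = ∑ b ∈ I, ∑ n ∈ R, μ.real (G b ∩ ({ω | N ω = n} ∩ (G a ∩ H))) :=
              Finset.sum_congr rfl fun b hb =>
                measureReal_inter_eq_sum_count μ I G N hN hNm (hG b hb) hGaH
        _ = ∑ n ∈ R, ∑ b ∈ I, μ.real (G b ∩ ({ω | N ω = n} ∩ (G a ∩ H))) := Finset.sum_comm
        _ = ∑ n ∈ R, (n : ℝ) * μ.real ({ω | N ω = n} ∩ (G a ∩ H)) :=
              Finset.sum_congr rfl fun n _ => sum_measureReal_inter_eq_mul μ I G hG N hN n (hmeasF' n)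
        _ = ∑ n ∈ R, (n : ℝ) * μ.real (G a ∩ ({ω | N ω = n} ∩ H)) :=
              Finset.sum_congr rfl fun n _ => by
                congr 2; ext ω; simp only [Set.mem_inter_iff, Set.mem_setOf_eq]; tauto
    calc ∑ a ∈ I, ∑ b ∈ I, μ.real (G a ∩ G b ∩ H)
        = ∑ a ∈ I, ∑ n ∈ R, (n : ℝ) * μ.real (G a ∩ ({ω | N ω = n} ∩ H)) :=
          Finset.sum_congr rfl hab
      _ = ∑ n ∈ R, ∑ a ∈ I, (n : ℝ) * μ.real (G a ∩ ({ω | N ω = n} ∩ H)) := Finset.sum_comm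
      _ = ∑ n ∈ R, (n : ℝ) ^ 2 * q n := Finset.sum_congr rfl fun n _ => by
          rw [← Finset.mul_sum, sum_measureReal_inter_eq_mul μ I G hG N hN n (hmeasF n), sq, mul_assoc]
  -- `P(H) = Σ_n q_n` and `P(H ∩ {N > θ}) = Σ_{n > θ} q_n`
  have hPH : μ.real H = ∑ n ∈ R, q n := by
    have h := hpart MeasurableSet.univ
    simp only [Set.univ_inter] at h
    exact h
  set T : Finset ℕ := R.filter fun n => θ < (n : ℝ) with hT
  have hPT : μ.real (H ∩ {ω | θ < N ω}) = ∑ n ∈ T, q n := by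
    have hAm : MeasurableSet {ω | θ < (N ω : ℝ)} := by
      have : {ω | θ < (N ω : ℝ)} = N ⁻¹' {n : ℕ | θ < (n : ℝ)} := by ext ω; simp
      rw [this]
      exact hNm (Set.to_countable _).measurableSet
    have h := hpart hAm
    rw [Set.inter_comm] at h
    rw [h, hT, Finset.sum_filter]
    refine Finset.sum_congr rfl fun n _ => ?_
    by_cases hn : θ < (n : ℝ)
    · rw [if_pos hn]
      congr 1
      ext ω
      simp only [Set.mem_inter_iff, Set.mem_setOf_eq]
      constructor
      · rintro ⟨-, h1, h2⟩; exact ⟨h1, h2⟩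
      · rintro ⟨h1, h2⟩; exact ⟨by rw [h1]; exact hn, h1, h2⟩
    · rw [if_neg hn]
      have : {ω | θ < (N ω : ℝ)} ∩ ({ω | N ω = n} ∩ H) = ∅ := by
        ext ω
        simp only [Set.mem_inter_iff, Set.mem_setOf_eq, Set.mem_empty_iff_false, iff_false, not_and]
        intro h1 h2 _
        rw [h2] at h1
        exact hn h1
      rw [this, measureReal_empty]
  -- the truncated first moment
  set Tc : Finset ℕ := R.filter fun n => ¬θ < (n : ℝ) with hTc
  have hsplit : ∑ n ∈ R, (n : ℝ) * q n = ∑ n ∈ T, (n : ℝ) * q n + ∑ n ∈ Tc, (n : ℝ) * q n :=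
    (Finset.sum_filter_add_sum_filter_not R (fun n : ℕ => θ < (n : ℝ)) (fun n : ℕ => (n : ℝ) * q n)).symm
  have hlow : ∑ n ∈ Tc, (n : ℝ) * q n ≤ θ * μ.real H := by
    calc ∑ n ∈ Tc, (n : ℝ) * q n ≤ ∑ n ∈ Tc, θ * q n := by
          refine Finset.sum_le_sum fun n hn => ?_
          have hn' : (n : ℝ) ≤ θ := not_lt.1 (Finset.mem_filter.1 hn).2
          exact mul_le_mul_of_nonneg_right hn' (hq0 n)
      _ = θ * ∑ n ∈ Tc, q n := by rw [Finset.mul_sum]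
      _ ≤ θ * ∑ n ∈ R, q n :=
          mul_le_mul_of_nonneg_left
            (Finset.sum_le_sum_of_subset_of_nonneg (Finset.filter_subset _ _) fun n _ _ => hq0 n) hθ
      _ = θ * μ.real H := by rw [hPH]
  have hTge : m - θ * μ.real H ≤ ∑ n ∈ T, (n : ℝ) * q n := by
    have : m ≤ ∑ n ∈ R, (n : ℝ) * q n := hm1 ▸ h1
    linarith
  have hT0 : 0 ≤ m - θ * μ.real H := by linarith
  -- Cauchy–Schwarz on `T`
  have hCS : (∑ n ∈ T, (n : ℝ) * q n) ^ 2 ≤ (∑ n ∈ T, (n : ℝ) ^ 2 * q n) * ∑ n ∈ T, q n := by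
    have h := Finset.sum_mul_sq_le_sq_mul_sq T (fun n => (n : ℝ) * Real.sqrt (q n)) fun n => Real.sqrt (q n)
    have e1 : ∀ n ∈ T, (n : ℝ) * Real.sqrt (q n) * Real.sqrt (q n) = (n : ℝ) * q n := fun n _ => by
      rw [mul_assoc, Real.mul_self_sqrt (hq0 n)]
    have e2 : ∀ n ∈ T, ((n : ℝ) * Real.sqrt (q n)) ^ 2 = (n : ℝ) ^ 2 * q n := fun n _ => by
      rw [mul_pow, Real.sq_sqrt (hq0 n)]
    have e3 : ∀ n ∈ T, Real.sqrt (q n) ^ 2 = q n := fun n _ => Real.sq_sqrt (hq0 n)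
    rwa [Finset.sum_congr rfl e1, Finset.sum_congr rfl e2, Finset.sum_congr rfl e3] at h
  have hT2 : ∑ n ∈ T, (n : ℝ) ^ 2 * q n ≤ s := by
    refine le_trans ?_ (hm2 ▸ h2)
    exact Finset.sum_le_sum_of_subset_of_nonneg (Finset.filter_subset _ _)
      fun n _ _ => mul_nonneg (sq_nonneg _) (hq0 n)
  have hTq0 : 0 ≤ ∑ n ∈ T, q n := Finset.sum_nonneg fun n _ => hq0 n
  calc (m - θ * μ.real H) ^ 2 ≤ (∑ n ∈ T, (n : ℝ) * q n) ^ 2 := pow_le_pow_left₀ hT0 hTge 2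
    _ ≤ (∑ n ∈ T, (n : ℝ) ^ 2 * q n) * ∑ n ∈ T, q n := hCS
    _ ≤ s * ∑ n ∈ T, q n := mul_le_mul_of_nonneg_right hT2 hTq0
    _ = s * μ.real (H ∩ {ω | θ < N ω}) := by rw [hPT]

end PaleyZygmund

/-! ### Measurability of admissibility and of `Y` -/

section Measurability

/-- `{(x, y) is (j, L, K)-admissible}` is measurable. [cite: KozmaNachmias2011, §5 (p. 398), admissible pairs] -/
theorem measurableSet_isAdmissible (p : unitInterval) (j L K : ℕ) (x y : Site d) :
    MeasurableSet {ω : BondConfig (Site d) | IsAdmissible p j L K x y ω} := by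
  have h1 : MeasurableSet (openConnIn (↑(box d j) : Set (Site d)) (0 : Site d) x) :=
    measurableSet_openConnIn (box d j) 0 x
  have h2 : MeasurableSet (openConn x y : Set (BondConfig (Site d))) := measurableSet_openConn_holds x y
  have h3 : MeasurableSet {ω : BondConfig (Site d) | IsKIrregular p j K x ω} :=
    measurableSet_isKIrregular p j K x
  have h4 : MeasurableSet {ω : BondConfig (Site d) | IsPivotal (openConn (0 : Site d) y) s(x, outerNeighbor j x) ω} :=
    measurableSet_setOf_isPivotal (isUpperSet_openConn 0 y) (measurableSet_openConn_holds 0 y) _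
  by_cases hc : x ∈ sphere d j ∧ y - x ∈ box d L ∧ y ∉ box d j
  · have : {ω : BondConfig (Site d) | IsAdmissible p j L K x y ω} =
        openConnIn (↑(box d j) : Set (Site d)) (0 : Site d) x ∩ (openConn x y : Set (BondConfig (Site d))) ∩
          {ω | IsKIrregular p j K x ω}ᶜ ∩ {ω | IsPivotal (openConn (0 : Site d) y) s(x, outerNeighbor j x) ω} := by
      ext ω
      simp only [IsAdmissible, Set.mem_setOf_eq, Set.mem_inter_iff, Set.mem_compl_iff]
      tauto
    rw [this]
    exact ((h1.inter h2).inter h3.compl).inter h4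
  · have : {ω : BondConfig (Site d) | IsAdmissible p j L K x y ω} = ∅ := by
      ext ω
      simp only [IsAdmissible, Set.mem_setOf_eq, Set.mem_empty_iff_false, iff_false]
      tauto
    rw [this]
    exact MeasurableSet.empty

/-- `Y(j, L, K)` in indicator form over the pairs `(x, w) ∈ ∂Q_j × Q_L`.
[cite: KozmaNachmias2011, §5 (p. 398), definition of Y(j,K,L)] -/
theorem admissibleCount_eq_sum_indicator (p : unitInterval) (j L K : ℕ) (ω : BondConfig (Site d)) :
    (admissibleCount d p j L K ω : ℝ) =
      ∑ q ∈ sphere d j ×ˢ box d L,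
        {ω' : BondConfig (Site d) | IsAdmissible p j L K q.1 (q.1 + q.2) ω'}.indicator (1 : BondConfig (Site d) → ℝ) ω := by
  classical
  have h1 : ∀ q ∈ sphere d j ×ˢ box d L,
      {ω' : BondConfig (Site d) | IsAdmissible p j L K q.1 (q.1 + q.2) ω'}.indicator (1 : BondConfig (Site d) → ℝ) ω =
        if IsAdmissible p j L K q.1 (q.1 + q.2) ω then 1 else 0 :=
    fun q _ => Set.indicator_apply _ 1 ω
  rw [Finset.sum_congr rfl h1, Finset.sum_boole]
  unfold admissibleCount
  congr 2

/-- `Y(j, L, K)` is measurable. [cite: KozmaNachmias2011, §5 (p. 398), definition of Y(j,K,L)] -/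
theorem measurable_admissibleCount (p : unitInterval) (j L K : ℕ) :
    Measurable (admissibleCount d p j L K) := by
  classical
  have hreal : Measurable fun ω : BondConfig (Site d) => (admissibleCount d p j L K ω : ℝ) := by
    have : (fun ω : BondConfig (Site d) => (admissibleCount d p j L K ω : ℝ)) =
        fun ω => ∑ q ∈ sphere d j ×ˢ box d L,
          {ω' : BondConfig (Site d) | IsAdmissible p j L K q.1 (q.1 + q.2) ω'}.indicator (1 : BondConfig (Site d) → ℝ) ω :=
      funext (admissibleCount_eq_sum_indicator p j L K)
    rw [this]
    exact Finset.measurable_sum _ fun q _ =>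
      (measurable_const.indicator (measurableSet_isAdmissible p j L K q.1 (q.1 + q.2)))
  refine measurable_to_countable' fun n => ?_
  have : admissibleCount d p j L K ⁻¹' {n} =
      (fun ω : BondConfig (Site d) => (admissibleCount d p j L K ω : ℝ)) ⁻¹' {(n : ℝ)} := by
    ext ω; simp
  rw [this]
  exact hreal (measurableSet_singleton _)

/-- `{X_j^{K-reg} = M}` is measurable. [cite: KozmaNachmias2011, §5 (p. 398), X_j^{K-reg} = X_j − X_j^{K-irr}] -/
theorem measurableSet_regBoundaryConnCount_eq (p : unitInterval) (j K M : ℕ) :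
    MeasurableSet {ω : BondConfig (Site d) | regBoundaryConnCount d p j K ω = M} :=
  measurable_regBoundaryConnCount_nat d p j K (measurableSet_singleton M)

end Measurability

/-! ### Lemma 5.1 as a named fact -/

section Facts

/-- NAMED FACT — **Kozma–Nachmias 2011, Lemma 5.1** (p. 398): "Let `K` be sufficiently large, and
let `j, M` and `L` be integers such that `M ≥ L²/2`. Then there exists a constant `c = c(K) > 0`
such that `E Y(j,K,L) 1_{X_j^{K-reg} = M} ≥ c M L² P(X_j^{K-reg} = M)`." Vendored, like Lemma 5.2
(`KozmaNachmias2011_lemma52`), in SUMMED form — `E[Y; X^{reg} = M] = Σ_{(x,y)} P((x,y) admissible,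
X^{reg} = M)`, the pairs enumerated as `(x, w) ∈ ∂Q_j × Q_L` with `y = x + w` — for the corrected
count of `KozmaNachmiasAdmissible.lean` (`y ∉ Q_j`), on the nearest-neighbour lattice `ℤ^d` under
the hypotheses (i) `d > 6`, (ii) `TwoPointBoundedRatio d` of the conditional Thm. 1 (§1.1), at
`p = p_c`, for `1 ≤ j`, `L ≤ j` (as in Theorem 2) and `L ≥ L₀(K)` (the printed proof, Lemmas 5.3
and 5.5, places the auxiliary vertex `x'` at distance of order `K` from `x` and sums the two-point
function over `y ∈ x + Q_L`, which is of order `L²` once `L` exceeds a multiple of `K`; in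
Theorem 2, `L ≥ j^{1/10}` and `j` is large). Its printed proof is Lemmas 5.3–5.5 and the local
modification of p. 404. Not proved here; users take `(h : KozmaNachmias2011_lemma51)`.
[cite: KozmaNachmias2011, Lemma 5.1 (p. 398)] -/
def KozmaNachmias2011_lemma51 : Prop :=
  ∀ d : ℕ, 6 < d → TwoPointBoundedRatio d →
    ∃ K₀ : ℕ, ∀ K : ℕ, K₀ ≤ K → ∃ c : ℝ, 0 < c ∧ ∃ L₀ : ℕ, ∀ j L M : ℕ,
      1 ≤ j → L₀ ≤ L → L ≤ j → (L : ℝ) ^ 2 ≤ 2 * M →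
      c * M * (L : ℝ) ^ 2 *
          (bondPercolation (zdGraph d) (criticalProbI d)).real
            {ω | regBoundaryConnCount d (criticalProbI d) j K ω = M} ≤
        ∑ q ∈ sphere d j ×ˢ box d L,
          (bondPercolation (zdGraph d) (criticalProbI d)).real
            ({ω | IsAdmissible (criticalProbI d) j L K q.1 (q.1 + q.2) ω} ∩
              {ω | regBoundaryConnCount d (criticalProbI d) j K ω = M})

end Facts

/-! ### Theorem 2 from Lemma 5.1 -/

section Assembly

/-- `{X_j^{K-reg} = M}` with `M ≥ 1` lies in the one-arm event `{0 ↔ ∂Q_j}` (`j ≥ 1`): some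
`x ∈ ∂Q_j` is joined to `0` inside `Q_j`. [cite: KozmaNachmias2011, proof of Thm. 2 (p. 399: "P(X^{reg} ≥ L²/2) ≤ P(0 ↔ ∂Q_j)")] -/
theorem setOf_regBoundaryConnCount_eq_subset_oneArm (p : unitInterval) {j : ℕ} (hj : 1 ≤ j) (K : ℕ)
    {M : ℕ} (hM : 1 ≤ M) :
    {ω : BondConfig (Site d) | regBoundaryConnCount d p j K ω = M} ⊆ oneArm d j := by
  classical
  intro ω hω
  rw [Set.mem_setOf_eq] at hω
  unfold regBoundaryConnCount at hω
  have hne : ((sphere d j).filter fun x =>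
      ω ∈ openConnIn (↑(box d j) : Set (Site d)) (0 : Site d) x ∧ ¬IsKIrregular p j K x ω).Nonempty := by
    rw [← Finset.card_pos, hω]; exact hM
  obtain ⟨x, hx⟩ := hne
  rw [Finset.mem_filter] at hx
  refine ⟨x, ?_, hx.2.1⟩
  rw [innerBoundary_box hj]
  exact hx.1

/-- The error term of Theorem 4 is negligible against `c/j²` (p. 399: "The first term is negligible
… our theorem is only supposed to hold for `j` sufficiently large"): for `a, C, ε > 0` there is `j₀`
with `C j^d e^{-a log² j} ≤ ε/j²` for all `j ≥ j₀`. [cite: KozmaNachmias2011, proof of Thm. 2 (p. 399)] -/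
theorem exists_pow_mul_exp_neg_log_sq_le {a C ε : ℝ} (ha : 0 < a) (hC : 0 < C) (hε : 0 < ε) (d : ℕ) :
    ∃ j₀ : ℕ, 1 ≤ j₀ ∧ ∀ j : ℕ, j₀ ≤ j →
      C * (j : ℝ) ^ d * Real.exp (-(a * Real.log j ^ 2)) ≤ ε / (j : ℝ) ^ 2 := by
  -- `j ≥ exp(2(d+2)/a)` gives `(d+2) log j ≤ (a/2) log² j`, whence the bound `C/j^{d+2} · j^d ≤ C/j²`… we
  -- arrange `C j^{d+2} e^{-a log² j} ≤ C e^{-(d+2) log j} · … ≤ C/j ≤ ε`.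
  obtain ⟨j₁, hj₁⟩ := exists_nat_ge (Real.exp (2 * (d + 3) / a))
  obtain ⟨j₂, hj₂⟩ := exists_nat_ge (C / ε)
  refine ⟨max (max j₁ j₂) 1, le_max_right _ _, fun j hj => ?_⟩
  have hj1 : 1 ≤ j := le_trans (le_max_right _ _) hj
  have hjR : (1 : ℝ) ≤ j := by exact_mod_cast hj1
  have hj0 : (0 : ℝ) < j := by linarith
  have hlog0 : 0 ≤ Real.log j := Real.log_nonneg hjR
  have hjj₁ : Real.exp (2 * (d + 3) / a) ≤ j :=
    hj₁.trans (by exact_mod_cast le_trans (le_trans (le_max_left _ _) (le_max_left _ _)) hj)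
  have hjj₂ : C / ε ≤ j := hj₂.trans (by exact_mod_cast le_trans (le_trans (le_max_right _ _) (le_max_left _ _)) hj)
  have hlog : 2 * (d + 3) / a ≤ Real.log j := by
    rw [Real.le_log_iff_exp_le hj0]; exact hjj₁
  -- `(d+3) log j ≤ (a/2) log² j`
  have hkey : ((d : ℝ) + 3) * Real.log j ≤ a / 2 * Real.log j ^ 2 := by
    have h1 : 2 * ((d : ℝ) + 3) ≤ a * Real.log j := by
      have := mul_le_mul_of_nonneg_left hlog ha.le
      rwa [mul_div_cancel₀ _ ha.ne'] at this
    nlinarith [hlog0, h1]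
  -- hence `j^{d+3} e^{-a log² j} ≤ 1`
  have hexp : (j : ℝ) ^ (d + 3) * Real.exp (-(a * Real.log j ^ 2)) ≤ 1 := by
    have e1 : (j : ℝ) ^ (d + 3) = Real.exp (((d : ℝ) + 3) * Real.log j) := by
      rw [← Real.exp_log (pow_pos hj0 (d + 3)), Real.log_pow]; push_cast; ring_nf
    rw [e1, ← Real.exp_add, Real.exp_le_one_iff]
    nlinarith [hkey, sq_nonneg (Real.log j), ha]
  have hCj : C ≤ ε * j := by
    rw [div_le_iff₀ hε] at hjj₂; linarith [hjj₂]
  -- assemble: `C j^d e^{-a log² j} j² = (C/j) · (j^{d+3} e^{-a log² j}) ≤ C/j ≤ ε`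
  have hj2 : (0 : ℝ) < (j : ℝ) ^ 2 := by positivity
  rw [le_div_iff₀ hj2]
  calc C * (j : ℝ) ^ d * Real.exp (-(a * Real.log j ^ 2)) * (j : ℝ) ^ 2
      = C / j * ((j : ℝ) ^ (d + 3) * Real.exp (-(a * Real.log j ^ 2))) := by
        field_simp
        ring
    _ ≤ C / j * 1 := mul_le_mul_of_nonneg_left hexp (by positivity)
    _ ≤ ε := by rw [mul_one, div_le_iff₀ hj0]; exact hCj

/-- **The second-moment step for one value of `M`** (p. 399: "Lemmas 5.1 and 5.2 give that
`P(Y > cML² | X^{reg} = M) > c` … and the fact that `A ≥ Y` …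
`P(X^{reg} = M and A ≤ cL⁴) ≤ (1 - c₂) P(X^{reg} = M)`"): from the first-moment lower bound (shape
of Lemma 5.1) and the second-moment upper bound (shape of Lemma 5.2) at `(j, K, L, M)` with
`L² ≤ 2M`, for every `c ≤ c₁/4`,
`P(X_j^{K-reg} = M, A_j ≤ c L⁴) ≤ (1 - min(c₁²/(4C₂), 1)) P(X_j^{K-reg} = M)`.
[cite: KozmaNachmias2011, proof of Thm. 2 (p. 399)] -/
theorem real_regEq_inter_annulus_le (p : unitInterval) (j K L M : ℕ) {c₁ C₂ c : ℝ}
    (hc₁ : 0 < c₁) (hC₂ : 0 < C₂) (hc : c ≤ c₁ / 4) (hL : 1 ≤ L) (hLM : (L : ℝ) ^ 2 ≤ 2 * M)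
    (h1 : c₁ * M * (L : ℝ) ^ 2 *
        (bondPercolation (zdGraph d) p).real {ω | regBoundaryConnCount d p j K ω = M} ≤
      ∑ q ∈ sphere d j ×ˢ box d L, (bondPercolation (zdGraph d) p).real
        ({ω | IsAdmissible p j L K q.1 (q.1 + q.2) ω} ∩ {ω | regBoundaryConnCount d p j K ω = M}))
    (h2 : ∑ q₁ ∈ sphere d j ×ˢ box d L, ∑ q₂ ∈ sphere d j ×ˢ box d L,
        (bondPercolation (zdGraph d) p).real
          ({ω | IsAdmissible p j L K q₁.1 (q₁.1 + q₁.2) ω} ∩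
            {ω | IsAdmissible p j L K q₂.1 (q₂.1 + q₂.2) ω} ∩
            {ω | regBoundaryConnCount d p j K ω = M}) ≤
      C₂ * (M : ℝ) ^ 2 * (L : ℝ) ^ 4 *
        (bondPercolation (zdGraph d) p).real {ω | regBoundaryConnCount d p j K ω = M}) :
    (bondPercolation (zdGraph d) p).real
        ({ω | regBoundaryConnCount d p j K ω = M} ∩
          {ω | (annulusConnCount d j L ω : ℝ) ≤ c * (L : ℝ) ^ 4}) ≤
      (1 - min (c₁ ^ 2 / (4 * C₂)) 1) *
        (bondPercolation (zdGraph d) p).real {ω | regBoundaryConnCount d p j K ω = M} := by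
  classical
  have hFm : MeasurableSet {ω : BondConfig (Site d) | regBoundaryConnCount d p j K ω = M} :=
    measurableSet_regBoundaryConnCount_eq p j K M
  have hYm : Measurable (admissibleCount d p j L K) := measurable_admissibleCount p j L K
  have hμF0 : 0 ≤ (bondPercolation (zdGraph d) p).real {ω | regBoundaryConnCount d p j K ω = M} :=
    measureReal_nonneg
  have hL1 : (1 : ℝ) ≤ L := by exact_mod_cast hL
  have hL0 : (0 : ℝ) < L := by linarith
  have hM0 : (0 : ℝ) < M := by nlinarith [hLM, hL1]
  have hL4 : (L : ℝ) ^ 4 ≤ 2 * M * (L : ℝ) ^ 2 := by nlinarith [hLM, sq_nonneg (L : ℝ)]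
  have hθ0 : 0 ≤ c₁ / 4 * (L : ℝ) ^ 4 := by positivity
  -- the Paley–Zygmund step with `θ = c₁ L⁴/4`
  have hm : c₁ / 4 * (L : ℝ) ^ 4 *
      (bondPercolation (zdGraph d) p).real {ω | regBoundaryConnCount d p j K ω = M} ≤
      c₁ * M * (L : ℝ) ^ 2 *
        (bondPercolation (zdGraph d) p).real {ω | regBoundaryConnCount d p j K ω = M} :=
    mul_le_mul_of_nonneg_right (by nlinarith [hL4, hc₁]) hμF0
  have hpz := sq_le_mul_measureReal_inter_lt_count (bondPercolation (zdGraph d) p)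
    (sphere d j ×ˢ box d L) (fun q => {ω | IsAdmissible p j L K q.1 (q.1 + q.2) ω})
    (fun q _ => measurableSet_isAdmissible p j L K q.1 (q.1 + q.2)) (admissibleCount d p j L K)
    (admissibleCount_eq_sum_indicator p j L K) hYm hFm hθ0 h1 h2 hm
  -- the event `{X^{reg} = M} ∩ {Y > θ}` and its complement inside `{X^{reg} = M}`
  have htm : MeasurableSet ({ω : BondConfig (Site d) | regBoundaryConnCount d p j K ω = M} ∩
      {ω | c₁ / 4 * (L : ℝ) ^ 4 < (admissibleCount d p j L K ω : ℝ)}) := by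
    refine hFm.inter ?_
    have : {ω : BondConfig (Site d) | c₁ / 4 * (L : ℝ) ^ 4 < (admissibleCount d p j L K ω : ℝ)} =
        admissibleCount d p j L K ⁻¹' {n : ℕ | c₁ / 4 * (L : ℝ) ^ 4 < (n : ℝ)} := by ext ω; simp
    rw [this]
    exact hYm (Set.to_countable _).measurableSet
  have hsplit := measureReal_inter_add_sdiff (μ := bondPercolation (zdGraph d) p)
    (s := {ω : BondConfig (Site d) | regBoundaryConnCount d p j K ω = M}) htm
  rw [Set.inter_eq_right.2 Set.inter_subset_left] at hsplit
  -- `A ≤ c L⁴ ≤ θ` and `Y ≤ A` exclude `{Y > θ}`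
  have hincl : {ω : BondConfig (Site d) | regBoundaryConnCount d p j K ω = M} ∩
        {ω | (annulusConnCount d j L ω : ℝ) ≤ c * (L : ℝ) ^ 4} ⊆
      {ω | regBoundaryConnCount d p j K ω = M} \
        ({ω | regBoundaryConnCount d p j K ω = M} ∩
          {ω | c₁ / 4 * (L : ℝ) ^ 4 < (admissibleCount d p j L K ω : ℝ)}) := by
    intro ω hω
    simp only [Set.mem_inter_iff, Set.mem_setOf_eq, Set.mem_sdiff, not_and, not_lt] at hω ⊢
    refine ⟨hω.1, fun _ => ?_⟩
    have hYA : (admissibleCount d p j L K ω : ℝ) ≤ (annulusConnCount d j L ω : ℝ) := by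
      exact_mod_cast admissibleCount_le_annulusConnCount p j L K ω
    have hcθ : c * (L : ℝ) ^ 4 ≤ c₁ / 4 * (L : ℝ) ^ 4 := mul_le_mul_of_nonneg_right hc (by positivity)
    exact hYA.trans (hω.2.trans hcθ)
  have hA1 : (bondPercolation (zdGraph d) p).real
        ({ω | regBoundaryConnCount d p j K ω = M} ∩ {ω | (annulusConnCount d j L ω : ℝ) ≤ c * (L : ℝ) ^ 4}) ≤
      (bondPercolation (zdGraph d) p).real {ω | regBoundaryConnCount d p j K ω = M} -
        (bondPercolation (zdGraph d) p).real
          ({ω | regBoundaryConnCount d p j K ω = M} ∩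
            {ω | c₁ / 4 * (L : ℝ) ^ 4 < (admissibleCount d p j L K ω : ℝ)}) := by
    refine (measureReal_mono hincl).trans (le_of_eq ?_)
    linarith [hsplit]
  -- abstract the probabilities
  generalize hμF : (bondPercolation (zdGraph d) p).real {ω | regBoundaryConnCount d p j K ω = M} = μF
    at hμF0 hpz hA1 ⊢
  generalize ht : (bondPercolation (zdGraph d) p).real
      ({ω | regBoundaryConnCount d p j K ω = M} ∩
        {ω | c₁ / 4 * (L : ℝ) ^ 4 < (admissibleCount d p j L K ω : ℝ)}) = t at hpz hA1
  have ht0 : 0 ≤ t := by rw [← ht]; exact measureReal_nonneg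
  -- algebra: `t ≥ c₂ μF`
  have hge : c₁ / 2 * M * (L : ℝ) ^ 2 * μF ≤ c₁ * M * (L : ℝ) ^ 2 * μF - c₁ / 4 * (L : ℝ) ^ 4 * μF := by
    have h := mul_le_mul_of_nonneg_left hL4 (by positivity : (0 : ℝ) ≤ c₁ / 4 * μF)
    nlinarith [h, hc₁, hμF0]
  have key : (c₁ / 2 * M * (L : ℝ) ^ 2 * μF) ^ 2 ≤ C₂ * (M : ℝ) ^ 2 * (L : ℝ) ^ 4 * μF * t :=
    le_trans (pow_le_pow_left₀ (by positivity) hge 2) hpz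
  have htc : min (c₁ ^ 2 / (4 * C₂)) 1 * μF ≤ t := by
    rcases hμF0.eq_or_lt with h0 | hpos
    · rw [← h0, mul_zero]; exact ht0
    · have hML : 0 < (M : ℝ) ^ 2 * (L : ℝ) ^ 4 * μF := by positivity
      have h3 : c₁ ^ 2 / 4 * μF ≤ C₂ * t := by
        by_contra hlt
        rw [not_le] at hlt
        have := mul_lt_mul_of_pos_left hlt hML
        have e1 : (M : ℝ) ^ 2 * (L : ℝ) ^ 4 * μF * (C₂ * t) =
            C₂ * (M : ℝ) ^ 2 * (L : ℝ) ^ 4 * μF * t := by ring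
        have e2 : (M : ℝ) ^ 2 * (L : ℝ) ^ 4 * μF * (c₁ ^ 2 / 4 * μF) =
            (c₁ / 2 * M * (L : ℝ) ^ 2 * μF) ^ 2 := by ring
        rw [e1, e2] at this
        exact absurd key (not_le.2 this)
      calc min (c₁ ^ 2 / (4 * C₂)) 1 * μF ≤ c₁ ^ 2 / (4 * C₂) * μF :=
            mul_le_mul_of_nonneg_right (min_le_left _ _) hμF0
        _ ≤ t := by
            rw [div_mul_eq_mul_div, div_le_iff₀ (by positivity)]
            linarith
  calc (bondPercolation (zdGraph d) p).real
        ({ω | regBoundaryConnCount d p j K ω = M} ∩ {ω | (annulusConnCount d j L ω : ℝ) ≤ c * (L : ℝ) ^ 4})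
      ≤ μF - t := hA1
    _ ≤ (1 - min (c₁ ^ 2 / (4 * C₂)) 1) * μF := by nlinarith [htc]

/-- **Kozma–Nachmias 2011, Theorem 2, PROVED from Lemma 5.1** (the "Proof of Theorem 2", p. 399):
granted the named fact `KozmaNachmias2011_lemma51` (Lemma 5.1 in summed form), Theorem 2 holds —
with Theorem 4 (`KozmaNachmias2011_thm4_holds`), Lemma 5.2 (`KozmaNachmias2011_lemma52`), (5.2)
(`admissibleCount_le_annulusConnCount`), the Paley–Zygmund step
(`sq_le_mul_measureReal_inter_lt_count`) and `P(0 ↔ ∂Q_j) ≥ c/j²`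
(`TwoPointBoundedRatio.oneArmProb_lower`) as the other inputs, all PROVED in the tree.
[cite: KozmaNachmias2011, Thm. 2 (p. 378) and its proof (p. 399)] -/
theorem KozmaNachmias2011_thm2_of_lemma51 (h51 : KozmaNachmias2011_lemma51) :
    KozmaNachmias2011_thm2 := by
  classical
  intro d hd hτ
  have hd4 : 4 ≤ d := by omega
  -- the inputs
  obtain ⟨C₄, c₄, hc₄, hc₄C₄, K₄, hT4⟩ := KozmaNachmias2011_thm4_holds d hd hτ
  obtain ⟨C₂, hC₂, h52⟩ := KozmaNachmias2011_lemma52 hd hτ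
  obtain ⟨K₅, h51K⟩ := h51 d hd hτ
  obtain ⟨c₁, hc₁, L₀, h51'⟩ := h51K (max K₄ K₅) (le_max_right _ _)
  obtain ⟨c₃, hc₃, hlow⟩ := hτ.oneArmProb_lower hd4
  have hC₄ : 0 < C₄ := hc₄.trans hc₄C₄
  -- the constants
  have hc₂ : 0 < min (c₁ ^ 2 / (4 * C₂)) 1 := lt_min (by positivity) one_pos
  have hc₂1 : min (c₁ ^ 2 / (4 * C₂)) 1 ≤ 1 := min_le_right _ _
  obtain ⟨j₁, hj₁1, hj₁⟩ := exists_pow_mul_exp_neg_log_sq_le (a := c₄ / 25) (C := C₄)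
    (ε := min (c₁ ^ 2 / (4 * C₂)) 1 / 2 * c₃) (by positivity) hC₄ (by positivity) d
  refine ⟨min (c₁ / 4) (min (c₁ ^ 2 / (4 * C₂)) 1 / 2), lt_min (by positivity) (by positivity),
    max j₁ (L₀ ^ 10), fun j hj L hLj hLj' => ?_⟩
  have hc_le₁ : min (c₁ / 4) (min (c₁ ^ 2 / (4 * C₂)) 1 / 2) ≤ c₁ / 4 := min_le_left _ _
  have hc_le₂ : min (c₁ / 4) (min (c₁ ^ 2 / (4 * C₂)) 1 / 2) ≤ min (c₁ ^ 2 / (4 * C₂)) 1 / 2 :=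
    min_le_right _ _
  generalize hcdef : min (c₁ / 4) (min (c₁ ^ 2 / (4 * C₂)) 1 / 2) = c at hc_le₁ hc_le₂ ⊢
  generalize hc₂def : min (c₁ ^ 2 / (4 * C₂)) 1 = c₂ at hc₂ hc₂1 hj₁ hc_le₂ ⊢
  have hjj₁ : j₁ ≤ j := le_trans (le_max_left _ _) hj
  have hj1 : 1 ≤ j := hj₁1.trans hjj₁
  have hjR : (1 : ℝ) ≤ j := by exact_mod_cast hj1
  have hj0 : (0 : ℝ) < j := by linarith
  -- `1 ≤ L`, `L₀ ≤ L`, `log L ≥ (log j)/10`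
  have hL1R : (1 : ℝ) ≤ L := le_trans (Real.one_le_rpow hjR (by norm_num)) hLj
  have hL1 : 1 ≤ L := by exact_mod_cast hL1R
  have hL₀L : L₀ ≤ L := by
    have hjL10 : (j : ℝ) ≤ (L : ℝ) ^ 10 := by
      have h := pow_le_pow_left₀ (by positivity) hLj 10
      rwa [← Real.rpow_natCast ((j : ℝ) ^ ((1 : ℝ) / 10)) 10, ← Real.rpow_mul hj0.le,
        show ((1 : ℝ) / 10 * ((10 : ℕ) : ℝ)) = 1 by norm_num, Real.rpow_one] at h
    have h1 : (L₀ : ℝ) ^ 10 ≤ (L : ℝ) ^ 10 := by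
      have : ((L₀ ^ 10 : ℕ) : ℝ) ≤ j := by exact_mod_cast le_trans (le_max_right _ _) hj
      push_cast at this
      linarith
    exact_mod_cast (pow_le_pow_iff_left₀ (by positivity) (by positivity) (by norm_num)).1 h1
  have hlogL : Real.log j / 10 ≤ Real.log L := by
    have h := Real.log_le_log (Real.rpow_pos_of_pos hj0 _) hLj
    rwa [Real.log_rpow hj0, one_div_mul_eq_div] at h
  have hlogj0 : 0 ≤ Real.log j := Real.log_nonneg hjR
  -- the events `F_M = {X^{K-reg} = M}` and the index set `S = {M ≤ |∂Q_j| : L² ≤ 2M}`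
  have hFm : ∀ M, MeasurableSet {ω : BondConfig (Site d) |
      regBoundaryConnCount d (criticalProbI d) j (max K₄ K₅) ω = M} := fun M =>
    measurableSet_regBoundaryConnCount_eq (criticalProbI d) j (max K₄ K₅) M
  set S : Finset ℕ := (Finset.range (#(sphere d j) + 1)).filter
    (fun M : ℕ => (L : ℝ) ^ 2 ≤ 2 * (M : ℝ)) with hS
  have hmemS : ∀ {M : ℕ}, M ∈ S ↔ M < #(sphere d j) + 1 ∧ (L : ℝ) ^ 2 ≤ 2 * (M : ℝ) := by
    intro M; rw [hS, Finset.mem_filter, Finset.mem_range]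
  -- (5.1): the split according to `X^{irr} ≥ X/2`
  have hsub : {ω : BondConfig (Site d) | (L : ℝ) ^ 2 ≤ boundaryConnCount d j ω ∧
        (annulusConnCount d j L ω : ℝ) ≤ c * (L : ℝ) ^ 4} ⊆
      {ω | L ^ 2 ≤ boundaryConnCount d j ω ∧
          boundaryConnCount d j ω ≤ 2 * irrBoundaryConnCount d (criticalProbI d) j (max K₄ K₅) ω} ∪
        ⋃ M ∈ S,
          ({ω | regBoundaryConnCount d (criticalProbI d) j (max K₄ K₅) ω = M} ∩
            {ω | (annulusConnCount d j L ω : ℝ) ≤ c * (L : ℝ) ^ 4}) := by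
    rintro ω ⟨h1, h2⟩
    have h1' : L ^ 2 ≤ boundaryConnCount d j ω := by exact_mod_cast h1
    by_cases h : boundaryConnCount d j ω ≤ 2 * irrBoundaryConnCount d (criticalProbI d) j (max K₄ K₅) ω
    · exact Or.inl ⟨h1', h⟩
    · refine Or.inr (Set.mem_iUnion₂.2 ⟨regBoundaryConnCount d (criticalProbI d) j (max K₄ K₅) ω, ?_, rfl, h2⟩)
      rw [hmemS]
      have hsum := boundaryConnCount_eq_irr_add_reg (criticalProbI d) j (max K₄ K₅) ω
      have hle : boundaryConnCount d j ω ≤ #(sphere d j) := boundaryConnCount_le_card_sphere j ω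
      refine ⟨by omega, ?_⟩
      have h3 : L ^ 2 ≤ 2 * regBoundaryConnCount d (criticalProbI d) j (max K₄ K₅) ω := by omega
      exact_mod_cast h3
  -- Theorem 4 for the first part
  have hE₄ : (bondPercolation (zdGraph d) (criticalProbI d)).real
      {ω | L ^ 2 ≤ boundaryConnCount d j ω ∧
        boundaryConnCount d j ω ≤ 2 * irrBoundaryConnCount d (criticalProbI d) j (max K₄ K₅) ω} ≤
      c₂ / 2 * oneArmProb d (criticalProbI d) j := by
    have h := hT4 (max K₄ K₅) (le_max_left _ _) j hj1 (L ^ 2)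
    have hlog2 : Real.log j ^ 2 / 25 ≤ Real.log (((L ^ 2 : ℕ) : ℝ)) ^ 2 := by
      push_cast
      rw [Real.log_pow]
      push_cast
      nlinarith [hlogL, hlogj0]
    calc (bondPercolation (zdGraph d) (criticalProbI d)).real
          {ω | L ^ 2 ≤ boundaryConnCount d j ω ∧
            boundaryConnCount d j ω ≤ 2 * irrBoundaryConnCount d (criticalProbI d) j (max K₄ K₅) ω}
        ≤ C₄ * (j : ℝ) ^ d * Real.exp (-(c₄ * Real.log (((L ^ 2 : ℕ) : ℝ)) ^ 2)) := h
      _ ≤ C₄ * (j : ℝ) ^ d * Real.exp (-(c₄ / 25 * Real.log j ^ 2)) := by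
          refine mul_le_mul_of_nonneg_left (Real.exp_le_exp.2 ?_) (by positivity)
          have := mul_le_mul_of_nonneg_left hlog2 hc₄.le
          linarith
      _ ≤ c₂ / 2 * c₃ / (j : ℝ) ^ 2 := hj₁ j hjj₁
      _ = c₂ / 2 * (c₃ / (j : ℝ) ^ 2) := by ring
      _ ≤ c₂ / 2 * oneArmProb d (criticalProbI d) j :=
          mul_le_mul_of_nonneg_left (hlow j hj1) (by positivity)
  -- the second-moment step for each `M ∈ S`
  have hPZ : ∀ M ∈ S,
      (bondPercolation (zdGraph d) (criticalProbI d)).real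
          ({ω | regBoundaryConnCount d (criticalProbI d) j (max K₄ K₅) ω = M} ∩
            {ω | (annulusConnCount d j L ω : ℝ) ≤ c * (L : ℝ) ^ 4}) ≤
        (1 - c₂) * (bondPercolation (zdGraph d) (criticalProbI d)).real
          {ω | regBoundaryConnCount d (criticalProbI d) j (max K₄ K₅) ω = M} := by
    intro M hMS
    rw [hmemS] at hMS
    have h := real_regEq_inter_annulus_le (criticalProbI d) j (max K₄ K₅) L M hc₁ hC₂ hc_le₁ hL1 hMS.2
      (h51' j L M hj1 hL₀L hLj' hMS.2) (h52 j (max K₄ K₅) L M hL1 hMS.2)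
    rwa [hc₂def] at h
  -- the union over `M ∈ S` lies in the one-arm event
  have hdisj : (↑(S) : Set ℕ).PairwiseDisjoint
      fun M => {ω : BondConfig (Site d) | regBoundaryConnCount d (criticalProbI d) j (max K₄ K₅) ω = M} := by
    intro M₁ _ M₂ _ hne
    rw [Function.onFun, Set.disjoint_left]
    intro ω h₁ h₂
    exact hne (h₁.symm.trans h₂)
  have hUnion : (bondPercolation (zdGraph d) (criticalProbI d)).real
      (⋃ M ∈ S,
        {ω : BondConfig (Site d) | regBoundaryConnCount d (criticalProbI d) j (max K₄ K₅) ω = M}) ≤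
      oneArmProb d (criticalProbI d) j := by
    refine measureReal_mono (Set.iUnion₂_subset fun M hMS => ?_)
    rw [hmemS] at hMS
    have hM1 : 1 ≤ M := by
      have h2M : (1 : ℝ) ≤ 2 * (M : ℝ) := le_trans (by nlinarith [hL1R]) hMS.2
      have hM0 : (0 : ℝ) < M := by linarith
      exact Nat.one_le_iff_ne_zero.2 (by rintro rfl; simp at hM0)
    exact setOf_regBoundaryConnCount_eq_subset_oneArm (criticalProbI d) hj1 (max K₄ K₅) hM1
  have hsumS : ∑ M ∈ S,
      (bondPercolation (zdGraph d) (criticalProbI d)).real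
          ({ω | regBoundaryConnCount d (criticalProbI d) j (max K₄ K₅) ω = M} ∩
            {ω | (annulusConnCount d j L ω : ℝ) ≤ c * (L : ℝ) ^ 4}) ≤
      (1 - c₂) * oneArmProb d (criticalProbI d) j := by
    refine (Finset.sum_le_sum hPZ).trans ?_
    rw [← Finset.mul_sum, measureReal_biUnion_finset hdisj fun M _ => hFm M] at *
    · exact mul_le_mul_of_nonneg_left hUnion (by linarith)
  -- conclusion
  have hπ0 : 0 ≤ oneArmProb d (criticalProbI d) j := measureReal_nonneg
  calc (bondPercolation (zdGraph d) (criticalProbI d)).real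
        {ω | (L : ℝ) ^ 2 ≤ boundaryConnCount d j ω ∧ (annulusConnCount d j L ω : ℝ) ≤ c * (L : ℝ) ^ 4}
      ≤ (bondPercolation (zdGraph d) (criticalProbI d)).real
          ({ω | L ^ 2 ≤ boundaryConnCount d j ω ∧
              boundaryConnCount d j ω ≤ 2 * irrBoundaryConnCount d (criticalProbI d) j (max K₄ K₅) ω} ∪
            ⋃ M ∈ S,
              ({ω | regBoundaryConnCount d (criticalProbI d) j (max K₄ K₅) ω = M} ∩
                {ω | (annulusConnCount d j L ω : ℝ) ≤ c * (L : ℝ) ^ 4})) := measureReal_mono hsub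
    _ ≤ (bondPercolation (zdGraph d) (criticalProbI d)).real
          {ω | L ^ 2 ≤ boundaryConnCount d j ω ∧
              boundaryConnCount d j ω ≤ 2 * irrBoundaryConnCount d (criticalProbI d) j (max K₄ K₅) ω} +
        (bondPercolation (zdGraph d) (criticalProbI d)).real
          (⋃ M ∈ S,
              ({ω | regBoundaryConnCount d (criticalProbI d) j (max K₄ K₅) ω = M} ∩
                {ω | (annulusConnCount d j L ω : ℝ) ≤ c * (L : ℝ) ^ 4})) := measureReal_union_le _ _
    _ ≤ c₂ / 2 * oneArmProb d (criticalProbI d) j +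
        ∑ M ∈ S,
          (bondPercolation (zdGraph d) (criticalProbI d)).real
            ({ω | regBoundaryConnCount d (criticalProbI d) j (max K₄ K₅) ω = M} ∩
              {ω | (annulusConnCount d j L ω : ℝ) ≤ c * (L : ℝ) ^ 4}) :=
        add_le_add hE₄ (measureReal_biUnion_finset_le _ _)
    _ ≤ c₂ / 2 * oneArmProb d (criticalProbI d) j + (1 - c₂) * oneArmProb d (criticalProbI d) j :=
        by linarith [hsumS]
    _ = (1 - c₂ / 2) * oneArmProb d (criticalProbI d) j := by ring
    _ ≤ (1 - c) * oneArmProb d (criticalProbI d) j := mul_le_mul_of_nonneg_right (by linarith) hπ0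

end Assembly


end Literature.Barriers.CriticalPhenomena

end
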